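import Mathlib
import Literature.Analysis.Matrix.EigenvalueCountOnSubspaces
import HarnessLib

/-!
# Inertia of the bordered (KKT) matrix controls definiteness of the constrained form: at most `m`
# negative eigenvalues and nonsingularity force `H ≻ 0` on `ker Σᵀ` (Gould 1985, Lemma 3.4;
# Forsgren–Gill–Murray 1991, Lemma 2.1)

Topic `Literature/LinearAlgebra/Matrix`, namespace `Literature.LinearAlgebra.Matrix.BorderedHessianInertia`.
Written for the venture ladder GRIDFUSION (cell G2-SCALE, object T3 = support P1 of idea card «idea-2 /
bordered-inertia-sync-certificate», HOME/IDEAS-G2.md sha16 8911c2c0321166ae; typed by gridfusion-lit-4 (g14),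
2026-08-28), but stated for abstract real symmetric matrices.  0 named facts, 0 kit, no `decide`.

THE PRINTED FRAME.  For the KKT (bordered Hessian) matrix `K = [H Aᵀ; A 0]` of an equality-constrained
quadratic programme (`H ∈ ℝ^{n×n}` symmetric, `A ∈ ℝ^{m×n}`), Forsgren–Gill–Murray state: «**Lemma 2.1.** Given
assumptions A3 [«The working-set matrix `A` has full row rank»] and A5 [«The reduced Hessian, `ZᵀHZ`, is positive
definite»], the inertia of the KKT matrix `K` is `(n, m, 0)`.  *Proof.* See Gould [8, Lemma 3.4].  Lemma 2.1
implies that `K` is nonsingular» (`Z` a basis of `ker A`; «the inertia of `M` — denoted by `In(M)` — is the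
associated integer triple `(i_p, i_n, i_z)`», §2.4).  Gould's Lemma 3.4 is the two-sided identity
`In(K) = In(ZᵀHZ) + (m, m, 0)` for full-row-rank `A`.  THIS FILE PROVES THE CONVERSE HALF that a CERTIFICATE
consumes: if `K` is nonsingular and has AT MOST `m` negative eigenvalues (counted with multiplicity), then
`uᵀHu > 0` for every `u ≠ 0` with `Au = 0` — no rank hypothesis on `A` is needed in this direction.  Proof
(Horn–Johnson Thm 4.2.10 (b), counting form, = the tree's
`Literature.Analysis.Matrix.EigenvalueCountOnSubspaces.card_le_card_eigenvalues_le`): a bad `u` spans, together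
with the `m` border coordinates, an `(m+1)`-dimensional subspace on which the form of `K` is
`a²·uᵀHu + 2a·(Au)ᵀw = a²·uᵀHu ≤ 0`, so `K` has `≥ m + 1` eigenvalues `≤ 0`, i.e. (no zero eigenvalue) `≥ m + 1`
negative ones.  USE (the card's certificate): the pivot signs of ONE exact symmetric elimination of `K` give the
count (Sylvester, the tree's `SylvesterInertiaLDL.card_eigenvalues_lt_eq_card_neg_pivots`), so «`H ≻ 0` on
`ker Σᵀ`» — the shape of the dVOC decrease condition (23) on the synchronous complement — is decided by a sparse
`LDLᵀ` with the border ordered last.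

## Contents (all PROVED; real symmetric matrices on finite index types `ι` (primal) and `κ` (border))
* `isHermitian_bordered` — `[H S; Sᵀ 0]` is symmetric when `H` is.
* `bordered_form_on_lift` — the form of the bordered matrix on `(a·u, w)` with `Sᵀu = 0` is `a²·uᵀHu`.
* **`posDef_on_ker_of_bordered_nonposCount`** — `#{i | λ_i(K) ≤ 0} ≤ |κ|` ⇒ `∀ u, Sᵀu = 0 → u ≠ 0 → 0 < uᵀHu`
  (determinant-free core; what a round-down `LDLᵀ` certificate with `|κ|` negative / otherwise positive pivots gives).
* **`posDef_on_ker_of_bordered_inertia`** — `#{i | λ_i(K) < 0} ≤ |κ|` and `det K ≠ 0` ⇒ the same.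
* `nonneg_on_ker_of_bordered_inertia` — the non-strict reading `0 ≤ uᵀHu` on `ker Sᵀ` (all `u`).
* THE SHIFTED-CORNER VARIANT (no determinant; the form a sparse negative-index certificate feeds):
  `isHermitian_shiftedBordered`, `shiftedBordered_form_on_lift` (the form of `[H S; Sᵀ −δI]` on `(a·u, w)` is
  `a²·uᵀHu − δ‖w‖²`), **`nonneg_on_ker_of_shiftedBordered_negIndex`** — `δ > 0` and
  `#{i | λ_i([H S; Sᵀ −δI]) < 0} ≤ |κ|` ⇒ `∀ u, Sᵀu = 0 → 0 ≤ uᵀHu` (strict count, Horn–Johnson 4.2.10 (b)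
  strict form = the tree's `EigenvalueCount.card_le_card_eigenvalues_lt`; the `−δI` corner makes the form
  NEGATIVE DEFINITE on the lift, so no nonsingularity hypothesis is needed — the penalty/Finsler reading of
  Gould's lemma).

## Sources
* A. Forsgren, P. E. Gill, W. Murray, *On the identification of local minimizers in inertia-controlling methods
  for quadratic programming*, SIAM J. Matrix Anal. Appl. 12 (1991) 730–746 [ForsgrenGillMurray1991]: §2.3
  assumptions A3/A5, §2.4 Lemma 2.1 [corpus: paper:doi-10-1137-0612057 p0003, read 2026-08-28].
* N. I. M. Gould, *On practical conditions for the existence and uniqueness of solutions to the general equality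
  quadratic programming problem*, Math. Programming 32 (1985) 90–99 [Gould1985], Lemma 3.4 (cited through
  [ForsgrenGillMurray1991]; not re-read here).
* R. A. Horn, C. R. Johnson, *Matrix Analysis* 2nd ed. (2013) [HornJohnson2013], Thm 4.2.10 (b) — via the tree.
-/

open Finset Matrix

namespace Literature.LinearAlgebra.Matrix.BorderedHessianInertia

open Literature.Analysis.Matrix

variable {ι κ : Type*} [Fintype ι] [DecidableEq ι] [Fintype κ] [DecidableEq κ]

omit [Fintype ι] [DecidableEq ι] [Fintype κ] [DecidableEq κ] in
/-- The bordered matrix `K = [H S; Sᵀ 0]` of a symmetric `H` and an arbitrary `S` is symmetric.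
[cite: ForsgrenGillMurray1991, §2.4 (the KKT matrix)] -/
theorem isHermitian_bordered {H : Matrix ι ι ℝ} (hH : H.IsHermitian) (S : Matrix ι κ ℝ) :
    (Matrix.fromBlocks H S Sᵀ (0 : Matrix κ κ ℝ)).IsHermitian := by
  refine Matrix.IsHermitian.fromBlocks hH ?_ (by
    show (0 : Matrix κ κ ℝ)ᴴ = 0
    simp)
  exact Matrix.conjTranspose_eq_transpose_of_trivial S

omit [DecidableEq ι] [DecidableEq κ] in
/-- **THE FORM OF THE BORDERED MATRIX ON A LIFT**: for `u` with `Sᵀu = 0`, a scalar `a` and any border vector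
`w`, the vector `x = (a·u, w)` has `xᵀKx = a²·uᵀHu` (the cross terms are `a·(Sᵀu)ᵀw = 0`, the corner block is
`0`). [cite: ForsgrenGillMurray1991, §2.4 Lemma 2.1] (the computation behind Gould's Lemma 3.4) -/
theorem bordered_form_on_lift (H : Matrix ι ι ℝ) (S : Matrix ι κ ℝ) {u : ι → ℝ} (hu : Sᵀ *ᵥ u = 0)
    (a : ℝ) (w : κ → ℝ) :
    Sum.elim (a • u) w ⬝ᵥ (Matrix.fromBlocks H S Sᵀ (0 : Matrix κ κ ℝ) *ᵥ Sum.elim (a • u) w)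
      = a ^ 2 * (u ⬝ᵥ H *ᵥ u) := by
  rw [Matrix.fromBlocks_mulVec]
  simp only [Sum.elim_comp_inl, Sum.elim_comp_inr, Matrix.zero_mulVec, add_zero]
  rw [sumElim_dotProduct_sumElim]
  have h1 : Sᵀ *ᵥ (a • u) = 0 := by rw [Matrix.mulVec_smul, hu, smul_zero]
  have h2 : a • u ⬝ᵥ S *ᵥ w = 0 := by
    rw [dotProduct_mulVec, ← Matrix.mulVec_transpose, h1, zero_dotProduct]
  rw [h1, dotProduct_zero, add_zero, dotProduct_add, h2, add_zero, Matrix.mulVec_smul,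
    dotProduct_smul, smul_dotProduct, smul_eq_mul, smul_eq_mul]
  ring

/-- **NONPOSITIVE COUNT ⇒ POSITIVE DEFINITENESS ON THE KERNEL** (the determinant-free core; the form a ROUND-DOWN
factorisation certificate `K ⪰ L D Lᵀ` with `|κ|` negative and otherwise positive pivots delivers through Sylvester +
Weyl): if the bordered matrix `K = [H S; Sᵀ 0]` has AT MOST `|κ|` eigenvalues `≤ 0` (counted with multiplicity), then
`uᵀHu > 0` for every `u ≠ 0` with `Sᵀu = 0`.  Proof: otherwise the `(|κ| + 1)`-dimensional span of `(u, 0)` and the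
border coordinates carries the form `a²·uᵀHu ≤ 0` (`bordered_form_on_lift`), so `K` has `≥ |κ| + 1` eigenvalues
`≤ 0` (Horn–Johnson 4.2.10 (b), counting form). [cite: Gould1985, Lemma 3.4] (converse half);
[cite: ForsgrenGillMurray1991, §2.4 Lemma 2.1]; [cite: HornJohnson2013, Theorem 4.2.10 (b)] -/
theorem posDef_on_ker_of_bordered_nonposCount {H : Matrix ι ι ℝ} (S : Matrix ι κ ℝ)
    (hK : (Matrix.fromBlocks H S Sᵀ (0 : Matrix κ κ ℝ)).IsHermitian)
    (hle : (univ.filter fun i => hK.eigenvalues i ≤ 0).card ≤ Fintype.card κ) :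
    ∀ u : ι → ℝ, Sᵀ *ᵥ u = 0 → u ≠ 0 → 0 < u ⬝ᵥ H *ᵥ u := by
  classical
  intro u hu hu0
  by_contra hle'
  rw [not_lt] at hle'
  -- the lift `V : (ι ⊕ κ) × (Unit ⊕ κ)`, columns `(u, 0)` and the border coordinate vectors
  let V : Matrix (ι ⊕ κ) (Unit ⊕ κ) ℝ := Matrix.fromBlocks (Matrix.of fun i _ => u i) 0 0 1
  have hVc : ∀ c : Unit ⊕ κ → ℝ, V *ᵥ c = Sum.elim (c (Sum.inl ()) • u) (c ∘ Sum.inr) := by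
    intro c
    rw [Matrix.fromBlocks_mulVec]
    simp only [Matrix.zero_mulVec, add_zero, zero_add, Matrix.one_mulVec]
    congr 1
    funext i
    simp [Matrix.mulVec, dotProduct, mul_comm]
  -- independence of the columns
  have hinj : ∀ c : Unit ⊕ κ → ℝ, V *ᵥ c = 0 → c = 0 := by
    intro c hc
    rw [hVc] at hc
    have h1 : c (Sum.inl ()) • u = 0 := by
      funext i
      have := congr_fun hc (Sum.inl i)
      simpa using this
    have h2 : ∀ k, c (Sum.inr k) = 0 := fun k => by
      have := congr_fun hc (Sum.inr k)
      simpa using this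
    have h3 : c (Sum.inl ()) = 0 := by
      by_contra hne
      apply hu0
      have := congr_arg (fun v => (c (Sum.inl ()))⁻¹ • v) h1
      simpa [smul_smul, inv_mul_cancel₀ hne] using this
    funext x
    rcases x with ⟨⟨⟩⟩ | k
    · exact h3
    · exact h2 k
  -- the form is `≤ 0` on the lift
  have hform : ∀ c : Unit ⊕ κ → ℝ,
      (V *ᵥ c) ⬝ᵥ (Matrix.fromBlocks H S Sᵀ (0 : Matrix κ κ ℝ)) *ᵥ (V *ᵥ c)
        ≤ 0 * ((V *ᵥ c) ⬝ᵥ (V *ᵥ c)) := by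
    intro c
    rw [hVc, bordered_form_on_lift H S hu, zero_mul]
    exact mul_nonpos_of_nonneg_of_nonpos (sq_nonneg _) hle'
  have hcount := Literature.Analysis.Matrix.EigenvalueCountOnSubspaces.card_le_card_eigenvalues_le
    hK V hinj hform
  have hcard : Fintype.card (Unit ⊕ κ) = Fintype.card κ + 1 := by
    rw [Fintype.card_sum, Fintype.card_unit]; ring
  rw [hcard] at hcount
  omega

/-- **BORDERED INERTIA ⇒ POSITIVE DEFINITENESS ON THE KERNEL** (the certificate-facing half of Gould's
Lemma 3.4 / Forsgren–Gill–Murray Lemma 2.1 «In(K) = (n, m, 0)»): if the bordered matrix `K = [H S; Sᵀ 0]`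
(`H` real symmetric on `ι`, `S : ι × κ`) has AT MOST `|κ|` negative eigenvalues and is nonsingular, then `uᵀHu > 0`
for every `u ≠ 0` with `Sᵀu = 0` — no zero eigenvalue (`det K = ∏ λ_i ≠ 0`), so the nonpositive count is the
negative count and `posDef_on_ker_of_bordered_nonposCount` applies.
[cite: Gould1985, Lemma 3.4] (converse half); [cite: ForsgrenGillMurray1991, §2.4 Lemma 2.1] -/
theorem posDef_on_ker_of_bordered_inertia {H : Matrix ι ι ℝ} (S : Matrix ι κ ℝ)
    (hK : (Matrix.fromBlocks H S Sᵀ (0 : Matrix κ κ ℝ)).IsHermitian)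
    (hneg : (univ.filter fun i => hK.eigenvalues i < 0).card ≤ Fintype.card κ)
    (hdet : (Matrix.fromBlocks H S Sᵀ (0 : Matrix κ κ ℝ)).det ≠ 0) :
    ∀ u : ι → ℝ, Sᵀ *ᵥ u = 0 → u ≠ 0 → 0 < u ⬝ᵥ H *ᵥ u := by
  classical
  refine posDef_on_ker_of_bordered_nonposCount S hK ?_
  -- no zero eigenvalue
  have hne0 : ∀ i, hK.eigenvalues i ≠ 0 := by
    intro i hi
    apply hdet
    rw [hK.det_eq_prod_eigenvalues]
    exact Finset.prod_eq_zero (Finset.mem_univ i) (by simp [hi])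
  have hsets : (univ.filter fun i => hK.eigenvalues i ≤ 0) = (univ.filter fun i => hK.eigenvalues i < 0) := by
    ext i
    simp only [mem_filter, mem_univ, true_and]
    exact ⟨fun h => lt_of_le_of_ne h (hne0 i), le_of_lt⟩
  rw [hsets]
  exact hneg

/-- The non-strict reading: under the same inertia data, `0 ≤ uᵀHu` for EVERY `u` with `Sᵀu = 0`.
[cite: Gould1985, Lemma 3.4] (converse half); [cite: ForsgrenGillMurray1991, §2.4 Lemma 2.1] -/
theorem nonneg_on_ker_of_bordered_inertia {H : Matrix ι ι ℝ} (S : Matrix ι κ ℝ)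
    (hK : (Matrix.fromBlocks H S Sᵀ (0 : Matrix κ κ ℝ)).IsHermitian)
    (hneg : (univ.filter fun i => hK.eigenvalues i < 0).card ≤ Fintype.card κ)
    (hdet : (Matrix.fromBlocks H S Sᵀ (0 : Matrix κ κ ℝ)).det ≠ 0) :
    ∀ u : ι → ℝ, Sᵀ *ᵥ u = 0 → 0 ≤ u ⬝ᵥ H *ᵥ u := by
  intro u hu
  by_cases hu0 : u = 0
  · subst hu0; simp
  · exact (posDef_on_ker_of_bordered_inertia S hK hneg hdet u hu hu0).le

/-! ## The shifted-corner variant `[H S; Sᵀ −δI]`: a pure negative-index hypothesis, no determinant -/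

omit [Fintype ι] [DecidableEq ι] [Fintype κ] in
/-- `[H S; Sᵀ −δI]` is symmetric when `H` is. [cite: ForsgrenGillMurray1991, §2.4 (the KKT matrix)] -/
theorem isHermitian_shiftedBordered {H : Matrix ι ι ℝ} (hH : H.IsHermitian) (S : Matrix ι κ ℝ) (δ : ℝ) :
    (Matrix.fromBlocks H S Sᵀ (-(δ • (1 : Matrix κ κ ℝ)))).IsHermitian := by
  refine Matrix.IsHermitian.fromBlocks hH ?_ ?_
  · exact Matrix.conjTranspose_eq_transpose_of_trivial S
  · show (-(δ • (1 : Matrix κ κ ℝ)))ᴴ = -(δ • (1 : Matrix κ κ ℝ))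
    rw [Matrix.conjTranspose_eq_transpose_of_trivial, Matrix.transpose_neg, Matrix.transpose_smul,
      Matrix.transpose_one]

omit [DecidableEq ι] in
/-- THE FORM OF THE SHIFTED BORDERED MATRIX ON A LIFT: for `Sᵀu = 0`,
`(a·u, w)ᵀ [H S; Sᵀ −δI] (a·u, w) = a²·uᵀHu − δ·‖w‖²`. [cite: ForsgrenGillMurray1991, §2.4 Lemma 2.1]
(the computation behind Gould's Lemma 3.4, with a penalised corner) -/
theorem shiftedBordered_form_on_lift (H : Matrix ι ι ℝ) (S : Matrix ι κ ℝ) {u : ι → ℝ} (hu : Sᵀ *ᵥ u = 0)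
    (δ a : ℝ) (w : κ → ℝ) :
    Sum.elim (a • u) w ⬝ᵥ (Matrix.fromBlocks H S Sᵀ (-(δ • (1 : Matrix κ κ ℝ))) *ᵥ Sum.elim (a • u) w)
      = a ^ 2 * (u ⬝ᵥ H *ᵥ u) - δ * (w ⬝ᵥ w) := by
  rw [Matrix.fromBlocks_mulVec]
  simp only [Sum.elim_comp_inl, Sum.elim_comp_inr]
  rw [sumElim_dotProduct_sumElim]
  have h1 : Sᵀ *ᵥ (a • u) = 0 := by rw [Matrix.mulVec_smul, hu, smul_zero]
  have h2 : a • u ⬝ᵥ S *ᵥ w = 0 := by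
    rw [dotProduct_mulVec, ← Matrix.mulVec_transpose, h1, zero_dotProduct]
  have h3 : -(δ • (1 : Matrix κ κ ℝ)) *ᵥ w = -(δ • w) := by
    rw [Matrix.neg_mulVec, Matrix.smul_mulVec, Matrix.one_mulVec]
  rw [h1, zero_add, h3, dotProduct_add, h2, add_zero, Matrix.mulVec_smul, dotProduct_smul, smul_dotProduct,
    smul_eq_mul, smul_eq_mul, dotProduct_neg, dotProduct_smul, smul_eq_mul]
  ring

/-- **SHIFTED BORDERED NEGATIVE INDEX ⇒ NONNEGATIVITY ON THE KERNEL** (penalty / Finsler reading of Gould's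
Lemma 3.4, the half a sparse inertia certificate consumes): if for some `δ > 0` the symmetric matrix
`[H S; Sᵀ −δI]` has AT MOST `|κ|` negative eigenvalues, then `uᵀHu ≥ 0` for every `u` with `Sᵀu = 0`.  No
nonsingularity is required: for a bad `u` the form on the `(|κ| + 1)`-dimensional lift is
`a²·uᵀHu − δ‖w‖² < 0` for `(a, w) ≠ 0`, so there are `≥ |κ| + 1` NEGATIVE eigenvalues (Horn–Johnson 4.2.10 (b),
strict counting form).  (The `−δI` corner always contributes `|κ|` negative eigenvalues, so the hypothesis says the
negative index is exactly `|κ|`.) [cite: Gould1985, Lemma 3.4] (converse half, penalised corner);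
[cite: ForsgrenGillMurray1991, §2.4 Lemma 2.1]; [cite: HornJohnson2013, Theorem 4.2.10 (b)] -/
theorem nonneg_on_ker_of_shiftedBordered_negIndex {H : Matrix ι ι ℝ} (S : Matrix ι κ ℝ) {δ : ℝ} (hδ : 0 < δ)
    (hK : (Matrix.fromBlocks H S Sᵀ (-(δ • (1 : Matrix κ κ ℝ)))).IsHermitian)
    (hneg : (univ.filter fun i => hK.eigenvalues i < 0).card ≤ Fintype.card κ) :
    ∀ u : ι → ℝ, Sᵀ *ᵥ u = 0 → 0 ≤ u ⬝ᵥ H *ᵥ u := by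
  classical
  intro u hu
  by_contra hlt
  rw [not_le] at hlt
  let V : Matrix (ι ⊕ κ) (Unit ⊕ κ) ℝ := Matrix.fromBlocks (Matrix.of fun i _ => u i) 0 0 1
  have hVc : ∀ c : Unit ⊕ κ → ℝ, V *ᵥ c = Sum.elim (c (Sum.inl ()) • u) (c ∘ Sum.inr) := by
    intro c
    rw [Matrix.fromBlocks_mulVec]
    simp only [Matrix.zero_mulVec, add_zero, zero_add, Matrix.one_mulVec]
    congr 1
    funext i
    simp [Matrix.mulVec, dotProduct, mul_comm]
  have hform : ∀ c : Unit ⊕ κ → ℝ, c ≠ 0 →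
      (V *ᵥ c) ⬝ᵥ (Matrix.fromBlocks H S Sᵀ (-(δ • (1 : Matrix κ κ ℝ)))) *ᵥ (V *ᵥ c)
        < 0 * ((V *ᵥ c) ⬝ᵥ (V *ᵥ c)) := by
    intro c hc
    rw [hVc, shiftedBordered_form_on_lift H S hu, zero_mul]
    have hw0 : 0 ≤ (c ∘ Sum.inr) ⬝ᵥ (c ∘ Sum.inr) := by
      have := dotProduct_star_self_nonneg (c ∘ Sum.inr)
      simpa using this
    by_cases ha : c (Sum.inl ()) = 0
    · -- then `w ≠ 0`
      have hw : (c ∘ Sum.inr) ≠ 0 := by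
        intro hw
        apply hc
        funext x
        rcases x with ⟨⟨⟩⟩ | k
        · exact ha
        · exact congr_fun hw k
      have hwpos : 0 < (c ∘ Sum.inr) ⬝ᵥ (c ∘ Sum.inr) := by
        have := dotProduct_star_self_pos_iff.mpr hw
        simpa using this
      rw [ha]
      nlinarith
    · have ha2 : 0 < c (Sum.inl ()) ^ 2 := by positivity
      nlinarith [mul_pos ha2 (neg_pos.mpr hlt)]
  have hcount := EigenvalueCount.card_le_card_eigenvalues_lt hK V hform
  have hcard : Fintype.card (Unit ⊕ κ) = Fintype.card κ + 1 := by
    rw [Fintype.card_sum, Fintype.card_unit]; ring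
  rw [hcard] at hcount
  omega

end Literature.LinearAlgebra.Matrix.BorderedHessianInertia
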